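import Mathlib.GroupTheory.ClassEquation
import Mathlib.GroupTheory.CommutingProbability
import Mathlib.GroupTheory.SpecificGroups.Cyclic
import Mathlib.GroupTheory.Index
import HarnessLib

/-!
# The `5/8` bound: a non-abelian finite group has at most `5|G|/8` conjugacy classes
# (Hart–Hedtke–Müller-Hannemann–Murthy, Lemma 3.3; Gustafson 1973)

Topic `Literature/GroupTheory/CommutingProbability` (companion of Mathlib's
`Mathlib.GroupTheory.CommutingProbability`, which defines `commProb` and proves
`commProb G = |ConjClasses G| / |G|` (`commProb_def'`) but not this bound).

S. Hart, I. Hedtke, M. Müller-Hannemann, S. Murthy, *A fast search algorithm for ⟨m,m,m⟩ Triple Product Property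
triples and an application for 5×5 matrix multiplication*, arXiv:1305.0448 (2013) = Groups Complex. Cryptol. 7
(2015), §3, read first-hand from the held text `paper:arxiv-1305.0448` (chunk p0007 L40–53; `T(G)` is "the number
of irreducible complex characters of `G`", p0007 L14–15, and "`T(G)` is known to equal the number of conjugacy
classes of `G`"), verbatim:

> **Lemma 3.3.** If `G` is non-abelian, then `T(G) ≤ (5/8)|G|`. Equality implies that `|G : Z(G)| = 4`.
> *Proof.* If the quotient `G/Z(G)` is cyclic, then `G` is abelian. Therefore if `G` is non-abelian, then
> `|G : Z(G)| ≥ 4`. Hence `|Z(G)| ≤ (1/4)|G|`. Now `T(G)` is known to equal the number of conjugacy classes of `G`.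
> For any `x ∈ G`, either `x` is central or `|x^G| ≥ 2`. The number of conjugacy classes of length at least `2` is
> `T(G) − |Z(G)|`. Therefore `|G| ≥ |Z(G)| + 2(T(G) − |Z(G)|)`. This implies `T(G) ≤ (1/2)(|G| + |Z(G)|) ≤ (5/8)|G|`.
> Equality is only possible when `|Z(G)| = (1/4)|G|`. □

("The following is well known" — the bound is W. H. Gustafson's, *What is the probability that two group
elements commute?*, Amer. Math. Monthly 80 (1973) 1031–1034; the original is listed below for attribution and was
not re-read for this file.)

## What is formalized (all proved; `0 defs / 0 facts`)
The printed proof, with the number of conjugacy classes `Nat.card (ConjClasses G)` for `T(G)`: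
* `HartEtAl2013.four_le_index_center` — "if `G` is non-abelian, then `|G : Z(G)| ≥ 4`" (`G/Z(G)` of order
  `1, 2, 3` is cyclic, Mathlib `MonoidHom.isMulCommutative_of_isCyclic_of_ker_le_center`);
* `HartEtAl2013.two_mul_card_conjClasses_le` — "`|G| ≥ |Z(G)| + 2(T(G) − |Z(G)|)`", i.e.
  `2·|ConjClasses G| ≤ |G| + |Z(G)|` (Mathlib's class equation `Group.card_center_add_sum_card_noncenter_eq_card`
  and `ConjClasses.mk_bijOn`: the central classes are the singletons, every other class has `≥ 2` elements);
* **`HartEtAl2013_lemma33`** — `8 · |ConjClasses G| ≤ 5 · |G|` for every finite group with two non-commuting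
  elements; `HartEtAl2013_lemma33_commProb` — `commProb G ≤ 5/8`; `HartEtAl2013_lemma33_eq` — the equality
  clause: `8 · |ConjClasses G| = 5 · |G|` forces `(center G).index = 4`.

## References
* S. Hart, I. Hedtke, M. Müller-Hannemann, S. Murthy, arXiv:1305.0448 = Groups Complex. Cryptol. 7 (2015):
  Lemma 3.3 with proof (held text p0007 L40–53). [HartEtAl2013]
* W. H. Gustafson, Amer. Math. Monthly 80 (1973) 1031–1034, doi:10.1080/00029890.1973.11993437 (original
  source of the bound; attribution only). [Gustafson1973]
-/

namespace Literature.GroupTheory.CommutingProbability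

open Subgroup

variable {G : Type*} [Group G]

namespace HartEtAl2013

/-- "If the quotient `G/Z(G)` is cyclic, then `G` is abelian. Therefore if `G` is non-abelian, then
`|G : Z(G)| ≥ 4`." [cite: HartEtAl2013, Lemma 3.3 (proof)] -/
theorem four_le_index_center [Finite G] (h : ∃ a b : G, a * b ≠ b * a) : 4 ≤ (center G).index := by
  obtain ⟨a, b, hab⟩ := h
  -- if the index is `1`, `2` or `3`, the quotient `G ⧸ Z(G)` is cyclic and `G` is abelian
  by_contra hlt
  push Not at hlt
  have hne : (center G).index ≠ 0 := Subgroup.index_ne_zero_of_finite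
  have hcomm : ∀ x y : G, x * y = y * x := by
    have hker : (QuotientGroup.mk' (center G)).ker ≤ center G := by
      rw [QuotientGroup.ker_mk']
    have key : ∀ n : ℕ, (center G).index = n → (n = 1 ∨ n.Prime) → ∀ x y : G, x * y = y * x := by
      intro n hn hn1
      have hcard : Nat.card (G ⧸ center G) = n := by rw [← hn, Subgroup.index]
      have hcyc : IsCyclic (G ⧸ center G) := by
        rcases hn1 with rfl | hp
        · haveI : Subsingleton (G ⧸ center G) := (Nat.card_eq_one_iff_unique.mp hcard).1
          exact isCyclic_of_subsingleton
        · haveI : Fact n.Prime := ⟨hp⟩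
          exact isCyclic_of_prime_card hcard
      haveI := MonoidHom.isMulCommutative_of_isCyclic_of_ker_le_center (QuotientGroup.mk' (center G)) hker
      exact fun x y => IsMulCommutative.is_comm.comm x y
    interval_cases hi : (center G).index
    · exact absurd rfl hne
    · exact key 1 rfl (Or.inl rfl)
    · exact key 2 rfl (Or.inr Nat.prime_two)
    · exact key 3 rfl (Or.inr Nat.prime_three)
  exact hab (hcomm a b)

/-- "For any `x ∈ G`, either `x` is central or `|x^G| ≥ 2`. The number of conjugacy classes of length at least
`2` is `T(G) − |Z(G)|`. Therefore `|G| ≥ |Z(G)| + 2(T(G) − |Z(G)|)`", stated as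
`2 · |ConjClasses G| ≤ |G| + |Z(G)|`. [cite: HartEtAl2013, Lemma 3.3 (proof)] -/
theorem two_mul_card_conjClasses_le [Finite G] :
    2 * Nat.card (ConjClasses G) ≤ Nat.card G + Nat.card (center G) := by
  classical
  cases nonempty_fintype G
  have hce := Group.card_center_add_sum_card_noncenter_eq_card G
  -- the central classes are in bijection with the centre
  have hz : Fintype.card (center G) = Fintype.card ((ConjClasses.noncenter G)ᶜ : Set (ConjClasses G)) :=
    Fintype.card_congr ((ConjClasses.mk_bijOn G).equiv _)
  have hsplit : (ConjClasses.noncenter G).toFinset.card +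
      ((ConjClasses.noncenter G)ᶜ : Set (ConjClasses G)).toFinset.card = Fintype.card (ConjClasses G) := by
    rw [Set.toFinset_compl, Finset.card_add_card_compl]
  -- every non-central class has at least two elements
  have htwo : ∀ x ∈ (ConjClasses.noncenter G).toFinset, 2 ≤ x.carrier.toFinset.card := by
    intro x hx
    rw [Set.mem_toFinset] at hx
    obtain ⟨a, ha, b, hb, hab⟩ := hx
    exact Finset.one_lt_card.2 ⟨a, Set.mem_toFinset.2 ha, b, Set.mem_toFinset.2 hb, hab⟩
  have hsum : (ConjClasses.noncenter G).toFinset.card * 2 ≤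
      ∑ x ∈ (ConjClasses.noncenter G).toFinset, x.carrier.toFinset.card := by
    simpa [smul_eq_mul] using
      Finset.card_nsmul_le_sum (ConjClasses.noncenter G).toFinset (fun x => x.carrier.toFinset.card) 2 htwo
  have hc : ((ConjClasses.noncenter G)ᶜ : Set (ConjClasses G)).toFinset.card = Fintype.card (center G) := by
    rw [Set.toFinset_card, ← hz]
  rw [Nat.card_eq_fintype_card, Nat.card_eq_fintype_card, Nat.card_eq_fintype_card]
  omega

end HartEtAl2013

/-- **Hart–Hedtke–Müller-Hannemann–Murthy, Lemma 3.3 (Gustafson's `5/8` bound)**: "If `G` is non-abelian, then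
`T(G) ≤ (5/8)|G|`", with `T(G)` the number of conjugacy classes (= the number of irreducible complex
characters): `8 · |ConjClasses G| ≤ 5 · |G|`. [cite: HartEtAl2013, Lemma 3.3] -/
theorem HartEtAl2013_lemma33 [Finite G] (h : ∃ a b : G, a * b ≠ b * a) :
    8 * Nat.card (ConjClasses G) ≤ 5 * Nat.card G := by
  have h4 := HartEtAl2013.four_le_index_center h
  have h2 := HartEtAl2013.two_mul_card_conjClasses_le (G := G)
  have hci : Nat.card (center G) * (center G).index = Nat.card G := (center G).card_mul_index
  have hz4 : 4 * Nat.card (center G) ≤ Nat.card G := by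
    calc 4 * Nat.card (center G) ≤ (center G).index * Nat.card (center G) := Nat.mul_le_mul_right _ h4
      _ = Nat.card G := by rw [mul_comm, hci]
  omega

/-- The same bound for the commuting probability: `commProb G ≤ 5/8` for a finite group with two non-commuting
elements. [cite: HartEtAl2013, Lemma 3.3] -/
theorem HartEtAl2013_lemma33_commProb [Finite G] (h : ∃ a b : G, a * b ≠ b * a) :
    commProb G ≤ 5 / 8 := by
  have hle := HartEtAl2013_lemma33 h
  have hpos : (0 : ℚ) < Nat.card G := by exact_mod_cast Nat.card_pos
  rw [commProb_def', div_le_div_iff₀ hpos (by norm_num)]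
  exact_mod_cast (by omega : Nat.card (ConjClasses G) * 8 ≤ 5 * Nat.card G)

/-- **Lemma 3.3, equality clause**: "Equality implies that `|G : Z(G)| = 4`." [cite: HartEtAl2013, Lemma 3.3] -/
theorem HartEtAl2013_lemma33_eq [Finite G] (h : ∃ a b : G, a * b ≠ b * a)
    (heq : 8 * Nat.card (ConjClasses G) = 5 * Nat.card G) : (center G).index = 4 := by
  have h4 := HartEtAl2013.four_le_index_center h
  have h2 := HartEtAl2013.two_mul_card_conjClasses_le (G := G)
  have hci : Nat.card (center G) * (center G).index = Nat.card G := (center G).card_mul_index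
  have hzpos : 0 < Nat.card (center G) := Nat.card_pos
  -- `4|Z| = |G|` is forced, hence the index is `4`
  have hz4 : 4 * Nat.card (center G) = Nat.card G := by
    have : 4 * Nat.card (center G) ≤ Nat.card G := by
      calc 4 * Nat.card (center G) ≤ (center G).index * Nat.card (center G) := Nat.mul_le_mul_right _ h4
        _ = Nat.card G := by rw [mul_comm, hci]
    omega
  have : Nat.card (center G) * (center G).index = Nat.card (center G) * 4 := by rw [hci, ← hz4, mul_comm]
  exact Nat.eq_of_mul_eq_mul_left hzpos this

end Literature.GroupTheory.CommutingProbability
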